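import Mathlib
import HarnessLib
import Summits.NavierStokesRegularity.NavierStokesRegularity.Theorems.PoloidalWindowDoorPoloidalWindowRigidityThreadShearHessian
import Summits.NavierStokesRegularity.NavierStokesRegularity.Theorems.PoloidalWindowDoorPoloidalWindowRigidityThreadNoXPoint
import Summits.NavierStokesRegularity.NavierStokesRegularity.Theorems.PoloidalWindowDoorPoloidalWindowRigidityThreadCentreExtremum
import Summits.NavierStokesRegularity.NavierStokesRegularity.Theorems.PoloidalWindowDoorPoloidalWindowRigidityLoopTangencyPin

/-!
# Route `PoloidalWindowDoor`, crux `PoloidalWindowRigidity` (K2, stmt-NavierStokesRegularity-19708) —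
# STUB Z1 `stub_threadZeroStructure` of line `centre_type` (ns-idea-8 g6, v4): the structure of the thread's
# vorticity zero — (A) shear Jacobian ∥ velocity Hessian, (B) NO X-POINT `det(H − M) ≥ 0`, (C) a CENTRE is a
# strict planar extremum of the stream function

Cell ns-regularity-ideate, seat ns-poloidal-K2-p2 g11 (stub-worker on K2; `--supports` the crux item).

* `det_hessian_sub_shear_nonneg` — PART B at class level: for the slice `v(−1)` of a poloidal profile of the route's
  Type-I class, hot-spot normalised at `(−1,0)`, with the thread pins and the hot spot an ISOLATED horizontal critical
  point of `v₂(−1,·)` on `{y₂ = 0}`, the horizontal Hessian `H − M` of the Clebsch stream function `ψ`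
  (`…ThreadCentreExtremum.clebsch_thread_package`) has `det(H − M) ≥ 0`.  Proof: if `det < 0`, take an isotropic
  direction `e = t e₀ + u e₁` of the Hessian and `n := (H − M)e`; the no-X-point lemma
  `…ThreadNoXPoint.exists_levelPoint_near` (bracket `{ψ, v₂} = 0`) produces horizontal points `y ≠ 0` arbitrarily
  close to `0` with `v₂(−1,y) = v₂(−1,0)`, which are global extrema of `v₂(−1,·)` hence horizontal critical points
  (`…LoopTangencyPin.fderiv_eq_zero_of_abs_le`) — contradicting isolation.
* `stub_threadZeroStructure` — the stub VERBATIM: part A (`…ThreadShearHessian.threadZeroStructure_partA`) ∧ part B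
  ∧ part C (`…ThreadCentreExtremum.centre_strictExtremum`).

WHAT THIS IS NOT: not a claim about Navier–Stokes regularity, not K2, not I2 — the provable structural stub Z1 of an
ideator line about HYPOTHETICAL poloidal Type-I blow-up profiles (it removes the X-point thread as a species, supplies
the inequality row `det(Hess_h v₂ − D_h∂_z v_h)(0) ≥ 0` at pin threadI, and feeds the centre cell to the proved
`LoopPeriodRatchet.NoPlanarExtremum`).  bears_on LADDER-NS N0, rung N0-LocalTubeDoorPoloidal.
-/

noncomputable section

-- the summit and its single sub-problem share the name (CONVENTIONS §1), as in every Theorems file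
set_option linter.dupNamespace false

namespace Summit.NavierStokesRegularity.NavierStokesRegularity.Theorems.PoloidalWindowDoorPoloidalWindowRigidityThreadZeroStructure

open MeasureTheory Set Function Filter Topology Metric
open scoped RealInnerProductSpace InnerProductSpace
open Literature.Analysis Literature.Analysis.FluidPDE
open Summit.NavierStokesRegularity.NavierStokesRegularity.Theorems.PoloidalWindowDoorPoloidalWindowRigidityConstantShearMeans
open Summit.NavierStokesRegularity.NavierStokesRegularity.Theorems.PoloidalWindowDoorPoloidalWindowRigidityWindow
open Summit.NavierStokesRegularity.NavierStokesRegularity.Theorems.PoloidalWindowDoorLrcModEntireMorseLevelRays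
open Summit.NavierStokesRegularity.NavierStokesRegularity.Theorems.PoloidalWindowDoorPoloidalWindowRigidityThreadShearHessian
open Summit.NavierStokesRegularity.NavierStokesRegularity.Theorems.PoloidalWindowDoorPoloidalWindowRigidityThreadNoXPoint
open Summit.NavierStokesRegularity.NavierStokesRegularity.Theorems.PoloidalWindowDoorPoloidalWindowRigidityThreadCentreExtremum
open Summit.NavierStokesRegularity.NavierStokesRegularity.Theorems.PoloidalWindowDoorPoloidalWindowRigidityLoopTangencyPin

/-! ### Part B: no X-point thread -/

/-- **PART B of Z1: `det(H − M) ≥ 0` — the thread's vorticity zero is never an X-point.**  For the slice `v(−1)` of a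
poloidal profile of the route's Type-I class with `√(−t)|v₂| ≤ |v₂(−1,0)|`, the thread pin `∇v₂(−1,0) = 0`, the
loop-tangency pins `∂_z v₀(−1,0) = ∂_z v₁(−1,0) = 0`, and the hot spot an isolated horizontal critical point of
`v₂(−1,·)` on the plane `{y₂ = 0}`:
`0 ≤ (H₀₀ − M₀₀)(H₁₁ − M₁₁) − (H₀₁ − M₀₁)(H₁₀ − M₁₀)` with `H_ab = ∂_b∂_a v₂(−1,0)`, `M_ab = ∂_b∂_z v_a(−1,0)`. -/
theorem det_hessian_sub_shear_nonneg {C : ℝ} {v : ℝ → EuclideanSpace ℝ (Fin 3) → EuclideanSpace ℝ (Fin 3)}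
    (hrate : HasTypeITimeDecay C v)
    (hcont : ContinuousOn (uncurry v) (Iio (0 : ℝ) ×ˢ univ))
    (hmild : ∀ s t : ℝ, s < t → t < 0 → ∀ x,
      v t x = UnboundedOperators.heatExtension (v s) (t - s) x - oseenDuhamel 1 s v v t x)
    (hdiv : ∀ t < 0, VectorCalculus.IsDivFree (v t))
    (hpol : ∀ s < 0, ∀ y, ⟪curl (v s) y, EuclideanSpace.single 2 1⟫_ℝ = 0)
    (hsup : ∀ t < 0, ∀ x, Real.sqrt (-t) * |v t x 2| ≤ |v (-1) 0 2|)
    (hgrad : ∀ h : EuclideanSpace ℝ (Fin 3), fderiv ℝ (v (-1)) 0 h 2 = 0)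
    (hiso : ∃ δ : ℝ, 0 < δ ∧ ∀ y : EuclideanSpace ℝ (Fin 3), y 2 = 0 → y ≠ 0 → ‖y‖ < δ →
      (fderiv ℝ (v (-1)) y (EuclideanSpace.single 0 1) 2 ≠ 0 ∨
        fderiv ℝ (v (-1)) y (EuclideanSpace.single 1 1) 2 ≠ 0))
    (hpin : fderiv ℝ (v (-1)) 0 (EuclideanSpace.single 2 1) 0 = 0 ∧
      fderiv ℝ (v (-1)) 0 (EuclideanSpace.single 2 1) 1 = 0) :
    0 ≤ (fderiv ℝ (fun x => fderiv ℝ (v (-1)) x (EuclideanSpace.single 0 1) 2) 0 (EuclideanSpace.single 0 1) -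
            fderiv ℝ (fun x => fderiv ℝ (v (-1)) x (EuclideanSpace.single 2 1) 0) 0 (EuclideanSpace.single 0 1)) *
          (fderiv ℝ (fun x => fderiv ℝ (v (-1)) x (EuclideanSpace.single 1 1) 2) 0 (EuclideanSpace.single 1 1) -
            fderiv ℝ (fun x => fderiv ℝ (v (-1)) x (EuclideanSpace.single 2 1) 1) 0 (EuclideanSpace.single 1 1)) -
          (fderiv ℝ (fun x => fderiv ℝ (v (-1)) x (EuclideanSpace.single 0 1) 2) 0 (EuclideanSpace.single 1 1) -
            fderiv ℝ (fun x => fderiv ℝ (v (-1)) x (EuclideanSpace.single 2 1) 0) 0 (EuclideanSpace.single 1 1)) *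
          (fderiv ℝ (fun x => fderiv ℝ (v (-1)) x (EuclideanSpace.single 1 1) 2) 0 (EuclideanSpace.single 0 1) -
            fderiv ℝ (fun x => fderiv ℝ (v (-1)) x (EuclideanSpace.single 2 1) 1) 0 (EuclideanSpace.single 0 1)) := by
  obtain ⟨δ, hδ, hiso⟩ := hiso
  have hA : IsTypeIAncientMild C v := isTypeIAncientMild_of_class hrate hcont hmild hdiv
  have hvs : ContDiff ℝ (⊤ : ℕ∞) (v (-1)) := hA.contDiff_slice (by norm_num)
  have hV2 : ContDiff ℝ 2 (v (-1)) := contDiff_infty.1 hvs 2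
  have hVd : Differentiable ℝ (v (-1)) := hV2.differentiable two_ne_zero
  obtain ⟨φ, ψ, -, hψ2, -, -, hbr0, hψ0, hS0, hS1⟩ :=
    clebsch_thread_package hrate hcont hmild hdiv hpol hgrad hpin
  -- the scalar `f = v₂(−1,·)`
  set f : EuclideanSpace ℝ (Fin 3) → ℝ := fun y => v (-1) y 2 with hf
  have hf1 : ContDiff ℝ 1 f := (contDiff_coord hV2 2).of_le (by norm_num)
  have hfq : ∀ y w, fderiv ℝ f y w = fderiv ℝ (v (-1)) y w 2 := fun y w => fderiv_coord_apply (hVd y) 2 w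
  -- pass to the Hessian entries of `ψ`
  rw [← hS0, ← hS0, ← hS1, ← hS1]
  have hsym : fderiv ℝ (fun y => fderiv ℝ ψ y (EuclideanSpace.single 0 1)) 0 (EuclideanSpace.single 1 1) =
      fderiv ℝ (fun y => fderiv ℝ ψ y (EuclideanSpace.single 1 1)) 0 (EuclideanSpace.single 0 1) :=
    fderiv_fderiv_symm hψ2 0 _ _
  -- bilinear expansion of the Hessian along horizontal vectors
  have hdψ : ∀ a : Fin 3, Differentiable ℝ fun y => fderiv ℝ ψ y (EuclideanSpace.single a 1) :=
    fun a => (contDiff_fderiv_apply_const hψ2 _).differentiable one_ne_zero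
  have hHess : ∀ w₀ w₁ d₀ d₁ : ℝ,
      fderiv ℝ (fun y => fderiv ℝ ψ y (w₀ • EuclideanSpace.single 0 1 + w₁ • EuclideanSpace.single 1 1)) 0
          (d₀ • EuclideanSpace.single 0 1 + d₁ • EuclideanSpace.single 1 1) =
        w₀ * (d₀ * fderiv ℝ (fun y => fderiv ℝ ψ y (EuclideanSpace.single 0 1)) 0 (EuclideanSpace.single 0 1) +
            d₁ * fderiv ℝ (fun y => fderiv ℝ ψ y (EuclideanSpace.single 0 1)) 0 (EuclideanSpace.single 1 1)) +
          w₁ * (d₀ * fderiv ℝ (fun y => fderiv ℝ ψ y (EuclideanSpace.single 1 1)) 0 (EuclideanSpace.single 0 1) +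
            d₁ * fderiv ℝ (fun y => fderiv ℝ ψ y (EuclideanSpace.single 1 1)) 0 (EuclideanSpace.single 1 1)) := by
    intro w₀ w₁ d₀ d₁
    have hfun : (fun y => fderiv ℝ ψ y (w₀ • EuclideanSpace.single 0 1 + w₁ • EuclideanSpace.single 1 1)) =
        fun y => w₀ * fderiv ℝ ψ y (EuclideanSpace.single 0 1) + w₁ * fderiv ℝ ψ y (EuclideanSpace.single 1 1) := by
      funext y
      rw [map_add, map_smul, map_smul, smul_eq_mul, smul_eq_mul]
    have hd0 : DifferentiableAt ℝ (fun y => w₀ * fderiv ℝ ψ y (EuclideanSpace.single 0 1)) 0 :=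
      ((hdψ 0) 0).const_mul w₀
    have hd1 : DifferentiableAt ℝ (fun y => w₁ * fderiv ℝ ψ y (EuclideanSpace.single 1 1)) 0 :=
      ((hdψ 1) 0).const_mul w₁
    rw [hfun, fderiv_fun_add hd0 hd1, _root_.add_apply, fderiv_const_mul ((hdψ 0) 0) w₀,
      fderiv_const_mul ((hdψ 1) 0) w₁]
    simp only [FunLike.coe_smul, Pi.smul_apply, smul_eq_mul, map_add, map_smul]
    ring
  -- the bracket along horizontal frames
  have hbrE : ∀ (t u n₀ n₁ : ℝ) (y : EuclideanSpace ℝ (Fin 3)),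
      fderiv ℝ ψ y (t • EuclideanSpace.single 0 1 + u • EuclideanSpace.single 1 1) *
          fderiv ℝ f y (n₀ • EuclideanSpace.single 0 1 + n₁ • EuclideanSpace.single 1 1) -
        fderiv ℝ ψ y (n₀ • EuclideanSpace.single 0 1 + n₁ • EuclideanSpace.single 1 1) *
          fderiv ℝ f y (t • EuclideanSpace.single 0 1 + u • EuclideanSpace.single 1 1) = 0 := by
    intro t u n₀ n₁ y
    simp only [map_add, map_smul, smul_eq_mul]
    simp only [hfq]
    linear_combination (u * n₀ - t * n₁) * hbr0 y
  -- name the Hessian entries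
  generalize hp : fderiv ℝ (fun y => fderiv ℝ ψ y (EuclideanSpace.single 0 1)) 0 (EuclideanSpace.single 0 1) = p
    at hHess ⊢
  generalize hq : fderiv ℝ (fun y => fderiv ℝ ψ y (EuclideanSpace.single 0 1)) 0 (EuclideanSpace.single 1 1) = q
    at hHess hsym ⊢
  generalize hq' : fderiv ℝ (fun y => fderiv ℝ ψ y (EuclideanSpace.single 1 1)) 0 (EuclideanSpace.single 0 1) = q'
    at hHess hsym ⊢
  generalize hr : fderiv ℝ (fun y => fderiv ℝ ψ y (EuclideanSpace.single 1 1)) 0 (EuclideanSpace.single 1 1) = r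
    at hHess ⊢
  subst hsym
  -- suppose the Hessian were indefinite
  by_contra hneg
  rw [not_le] at hneg
  -- an isotropic pair `(t, u) ≠ 0`
  obtain ⟨t, u, htu, hQ⟩ : ∃ t u : ℝ, (t ≠ 0 ∨ u ≠ 0) ∧ p * t ^ 2 + 2 * q * t * u + r * u ^ 2 = 0 := by
    by_cases hp0 : p = 0
    · exact ⟨1, 0, Or.inl one_ne_zero, by simp [hp0]⟩
    · set s := Real.sqrt (q ^ 2 - p * r) with hs_def
      have hs : s ^ 2 = q ^ 2 - p * r := Real.sq_sqrt (by nlinarith)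
      refine ⟨(-q + s) / p, 1, Or.inr one_ne_zero, ?_⟩
      have hpt : p * ((-q + s) / p) = -q + s := by field_simp
      have key : p * (p * ((-q + s) / p) ^ 2 + 2 * q * ((-q + s) / p) * 1 + r * 1 ^ 2) = 0 := by
        have h1 : p * (p * ((-q + s) / p) ^ 2 + 2 * q * ((-q + s) / p) * 1 + r * 1 ^ 2) =
            (p * ((-q + s) / p)) ^ 2 + 2 * q * (p * ((-q + s) / p)) + p * r := by ring
        rw [h1, hpt]
        linear_combination hs
      exact (mul_eq_zero.1 key).resolve_left hp0
  -- the transversal direction `n = (H − M)e`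
  set n₀ : ℝ := p * t + q * u with hn₀
  set n₁ : ℝ := q * t + r * u with hn₁
  have hc : 0 < n₀ ^ 2 + n₁ ^ 2 := by
    rcases (add_nonneg (sq_nonneg n₀) (sq_nonneg n₁)).lt_or_eq with h | h
    · exact h
    · exfalso
      have h0 : n₀ = 0 := by nlinarith [sq_nonneg n₀, sq_nonneg n₁]
      have h1 : n₁ = 0 := by nlinarith [sq_nonneg n₀, sq_nonneg n₁]
      have ht : (p * r - q * q) * t = 0 := by
        have : (p * r - q * q) * t = r * n₀ - q * n₁ := by rw [hn₀, hn₁]; ring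
        rw [this, h0, h1]; ring
      have hu : (p * r - q * q) * u = 0 := by
        have : (p * r - q * q) * u = p * n₁ - q * n₀ := by rw [hn₀, hn₁]; ring
        rw [this, h0, h1]; ring
      have hne : p * r - q * q ≠ 0 := hneg.ne
      rcases htu with h' | h'
      · exact h' ((mul_eq_zero.1 ht).resolve_left hne)
      · exact h' ((mul_eq_zero.1 hu).resolve_left hne)
  set e : EuclideanSpace ℝ (Fin 3) := t • EuclideanSpace.single 0 1 + u • EuclideanSpace.single 1 1 with he
  set n : EuclideanSpace ℝ (Fin 3) := n₀ • EuclideanSpace.single 0 1 + n₁ • EuclideanSpace.single 1 1 with hn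
  -- hypotheses of the no-X-point lemma
  have he0 : fderiv ℝ ψ 0 e = 0 := hψ0 t u
  have hn0 : fderiv ℝ ψ 0 n = 0 := hψ0 n₀ n₁
  have hee : fderiv ℝ (fun y => fderiv ℝ ψ y e) 0 e = 0 := by
    rw [he, hHess t u t u]
    linear_combination hQ
  have hne : 0 < fderiv ℝ (fun y => fderiv ℝ ψ y n) 0 e := by
    rw [hn, he, hHess n₀ n₁ t u]
    have h1 : n₀ * (t * p + u * q) + n₁ * (t * q + u * r) = n₀ ^ 2 + n₁ ^ 2 := by rw [hn₀, hn₁]; ring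
    rw [h1]
    exact hc
  have hbr : ∀ y, fderiv ℝ ψ y e * fderiv ℝ f y n - fderiv ℝ ψ y n * fderiv ℝ f y e = 0 := fun y =>
    hbrE t u n₀ n₁ y
  -- the level point near the thread
  obtain ⟨a, b, hy0, hyδ, hfy⟩ := exists_levelPoint_near hψ2 hf1 hbr he0 hn0 hee hne hδ
  have hy2 : (a • e + b • n) 2 = 0 := by simp [he, hn]
  have hext : ∀ z, |f z| ≤ |f (a • e + b • n)| := fun z => by
    rw [hfy]
    have h := hsup (-1) (by norm_num) z
    simpa [hf] using h
  have hDf : fderiv ℝ f (a • e + b • n) = 0 := fderiv_eq_zero_of_abs_le hext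
  have h0' : fderiv ℝ (v (-1)) (a • e + b • n) (EuclideanSpace.single 0 1) 2 = 0 := by
    rw [← hfq, hDf]; simp
  have h1' : fderiv ℝ (v (-1)) (a • e + b • n) (EuclideanSpace.single 1 1) 2 = 0 := by
    rw [← hfq, hDf]; simp
  rcases hiso (a • e + b • n) hy2 hy0 hyδ with h | h
  · exact h h0'
  · exact h h1'

/-! ### The stub -/

/-- **STUB Z1 `stub_threadZeroStructure` (VERBATIM, line `centre_type` v4 of crux `PoloidalWindowRigidity`):
STRUCTURE OF THE THREAD'S VORTICITY ZERO.**  Class profile, poloidal, `N = v₂(−1,0) ≠ 0`, hot-spot bound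
`√(−t)|v₂| ≤ |N|`, thread pin `∇v₂(−1,0) = 0`, isolation of the horizontal critical point, and the loop-tangency
pins `∂_z v_h(−1,0) = 0`.  Conclusion with `H_ab = ∂_b∂_a v₂(−1,0)`, `M_ab = ∂_b∂_z v_a(−1,0)`: (i) `M` symmetric,
(ii) `tr M = −∂_z²v₂(−1,0)`, (iii) `∃ (c₁,c₂) ≠ 0, c₁M = c₂H`, (iv) `0 ≤ det(H − M)` (no X-point), (v) if
`0 < det(H − M)` the stream function `v₂ − ∂_zΦ` has a strict planar extremum at the thread.  Parts (i)–(iii):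
`…ThreadShearHessian.threadZeroStructure_partA`; (iv): `det_hessian_sub_shear_nonneg`; (v):
`…ThreadCentreExtremum.centre_strictExtremum`. -/
theorem stub_threadZeroStructure :
    ∀ (C : ℝ) (v : ℝ → EuclideanSpace ℝ (Fin 3) → EuclideanSpace ℝ (Fin 3)),
      Literature.Analysis.FluidPDE.HasTypeITimeDecay C v →
      ContinuousOn (Function.uncurry v) (Set.Iio (0 : ℝ) ×ˢ Set.univ) →
      (∀ s t : ℝ, s < t → t < 0 → ∀ x, v t x =
        Literature.Analysis.UnboundedOperators.heatExtension (v s) (t - s) x -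
          Literature.Analysis.FluidPDE.oseenDuhamel 1 s v v t x) →
      (∀ t < 0, Literature.Analysis.FluidPDE.VectorCalculus.IsDivFree (v t)) →
      (∀ s < 0, ∀ y, ⟪Literature.Analysis.FluidPDE.curl (v s) y, EuclideanSpace.single 2 1⟫_ℝ = 0) →
      v (-1) 0 2 ≠ 0 → (∀ t < 0, ∀ x, Real.sqrt (-t) * |v t x 2| ≤ |v (-1) 0 2|) →
      (∀ h : EuclideanSpace ℝ (Fin 3), fderiv ℝ (v (-1)) 0 h 2 = 0) →
      (∃ δ : ℝ, 0 < δ ∧ ∀ y : EuclideanSpace ℝ (Fin 3), y 2 = 0 → y ≠ 0 → ‖y‖ < δ →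
          (fderiv ℝ (v (-1)) y (EuclideanSpace.single 0 1) 2 ≠ 0 ∨ fderiv ℝ (v (-1)) y (EuclideanSpace.single 1 1) 2 ≠ 0)) →
      (fderiv ℝ (v (-1)) 0 (EuclideanSpace.single 2 1) 0 = 0 ∧ fderiv ℝ (v (-1)) 0 (EuclideanSpace.single 2 1) 1 = 0) →
      (fderiv ℝ (fun x => fderiv ℝ (v (-1)) x (EuclideanSpace.single 2 1) 0) 0 (EuclideanSpace.single 1 1) =
            fderiv ℝ (fun x => fderiv ℝ (v (-1)) x (EuclideanSpace.single 2 1) 1) 0 (EuclideanSpace.single 0 1) ∧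
          fderiv ℝ (fun x => fderiv ℝ (v (-1)) x (EuclideanSpace.single 2 1) 0) 0 (EuclideanSpace.single 0 1) +
              fderiv ℝ (fun x => fderiv ℝ (v (-1)) x (EuclideanSpace.single 2 1) 1) 0 (EuclideanSpace.single 1 1) =
            -fderiv ℝ (fun x => fderiv ℝ (v (-1)) x (EuclideanSpace.single 2 1) 2) 0 (EuclideanSpace.single 2 1)) ∧
        ((∃ c₁ c₂ : ℝ, (c₁ ≠ 0 ∨ c₂ ≠ 0) ∧ ∀ a b : Fin 3, a ≠ 2 → b ≠ 2 →
            c₁ * fderiv ℝ (fun x => fderiv ℝ (v (-1)) x (EuclideanSpace.single 2 1) a) 0 (EuclideanSpace.single b 1) =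
              c₂ * fderiv ℝ (fun x => fderiv ℝ (v (-1)) x (EuclideanSpace.single a 1) 2) 0 (EuclideanSpace.single b 1))) ∧
        0 ≤ (fderiv ℝ (fun x => fderiv ℝ (v (-1)) x (EuclideanSpace.single 0 1) 2) 0 (EuclideanSpace.single 0 1) -
            fderiv ℝ (fun x => fderiv ℝ (v (-1)) x (EuclideanSpace.single 2 1) 0) 0 (EuclideanSpace.single 0 1)) *
          (fderiv ℝ (fun x => fderiv ℝ (v (-1)) x (EuclideanSpace.single 1 1) 2) 0 (EuclideanSpace.single 1 1) -
            fderiv ℝ (fun x => fderiv ℝ (v (-1)) x (EuclideanSpace.single 2 1) 1) 0 (EuclideanSpace.single 1 1)) -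
          (fderiv ℝ (fun x => fderiv ℝ (v (-1)) x (EuclideanSpace.single 0 1) 2) 0 (EuclideanSpace.single 1 1) -
            fderiv ℝ (fun x => fderiv ℝ (v (-1)) x (EuclideanSpace.single 2 1) 0) 0 (EuclideanSpace.single 1 1)) *
          (fderiv ℝ (fun x => fderiv ℝ (v (-1)) x (EuclideanSpace.single 1 1) 2) 0 (EuclideanSpace.single 0 1) -
            fderiv ℝ (fun x => fderiv ℝ (v (-1)) x (EuclideanSpace.single 2 1) 1) 0 (EuclideanSpace.single 0 1)) ∧
        (0 < (fderiv ℝ (fun x => fderiv ℝ (v (-1)) x (EuclideanSpace.single 0 1) 2) 0 (EuclideanSpace.single 0 1) -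
            fderiv ℝ (fun x => fderiv ℝ (v (-1)) x (EuclideanSpace.single 2 1) 0) 0 (EuclideanSpace.single 0 1)) *
          (fderiv ℝ (fun x => fderiv ℝ (v (-1)) x (EuclideanSpace.single 1 1) 2) 0 (EuclideanSpace.single 1 1) -
            fderiv ℝ (fun x => fderiv ℝ (v (-1)) x (EuclideanSpace.single 2 1) 1) 0 (EuclideanSpace.single 1 1)) -
          (fderiv ℝ (fun x => fderiv ℝ (v (-1)) x (EuclideanSpace.single 0 1) 2) 0 (EuclideanSpace.single 1 1) -
            fderiv ℝ (fun x => fderiv ℝ (v (-1)) x (EuclideanSpace.single 2 1) 0) 0 (EuclideanSpace.single 1 1)) *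
          (fderiv ℝ (fun x => fderiv ℝ (v (-1)) x (EuclideanSpace.single 1 1) 2) 0 (EuclideanSpace.single 0 1) -
            fderiv ℝ (fun x => fderiv ℝ (v (-1)) x (EuclideanSpace.single 2 1) 1) 0 (EuclideanSpace.single 0 1)) →
          ∃ Φ : EuclideanSpace ℝ (Fin 3) → ℝ, ContDiff ℝ 2 Φ ∧
            (∀ y, v (-1) y 0 = fderiv ℝ Φ y (EuclideanSpace.single 0 1) ∧
              v (-1) y 1 = fderiv ℝ Φ y (EuclideanSpace.single 1 1)) ∧
            ((∀ᶠ y in nhdsWithin (0 : EuclideanSpace ℝ (Fin 3)) {y | y 2 = (0 : EuclideanSpace ℝ (Fin 3)) 2 ∧ y ≠ 0},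
                v (-1) 0 2 - fderiv ℝ Φ 0 (EuclideanSpace.single 2 1) <
                  v (-1) y 2 - fderiv ℝ Φ y (EuclideanSpace.single 2 1)) ∨
              (∀ᶠ y in nhdsWithin (0 : EuclideanSpace ℝ (Fin 3)) {y | y 2 = (0 : EuclideanSpace ℝ (Fin 3)) 2 ∧ y ≠ 0},
                v (-1) y 2 - fderiv ℝ Φ y (EuclideanSpace.single 2 1) <
                  v (-1) 0 2 - fderiv ℝ Φ 0 (EuclideanSpace.single 2 1)))) := by
  intro C v hrate hcont hmild hdiv hpol _hN hsup hgrad hiso hpin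
  obtain ⟨hA12, hA3⟩ := threadZeroStructure_partA hrate hcont hmild hdiv hpol hgrad hpin
  exact ⟨hA12, hA3, det_hessian_sub_shear_nonneg hrate hcont hmild hdiv hpol hsup hgrad hiso hpin,
    fun hdet => centre_strictExtremum hrate hcont hmild hdiv hpol hgrad hpin hdet⟩

end Summit.NavierStokesRegularity.NavierStokesRegularity.Theorems.PoloidalWindowDoorPoloidalWindowRigidityThreadZeroStructure

end
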